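import Literature.Probability.Percolation.ChayesLeiHexProofs
import HarnessLib

/-!
# Route CardyBondTriangular · crux `BondTriangularCardy` · line `birth`: the two yellow arms of Claim 10 for the Chayes–Lei separating events

Helper of the stub `stub_equicontinuity` (hypothesis (A), yellow part, of the assembly
`equicontinuity_of_arms_of_annulusBounds`): the easy half of Claim 10 of Bollobás–Riordan,
*Percolation* (2006), Ch. 7, p. 177 ("`x₁x₂` is an edge of `P`; let `P₁`, `P₂` be the two parts
of `P`"), for the yellow separating events `clSepEvent` of a Chayes–Lei hexagon model on a
3-marked discrete domain `G` of `𝕋` (Chayes–Lei, Rev. Math. Phys. 19 (2007), §2.1–2.3). If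
`Eⁱ(z) ∖ Eⁱ(w)` holds, `z` the dual neighbour of the triangle `w ⊆ G` across its side `x₁x₂`,
then the yellow `A_{i+1}`–`A_{i+2}` path `P` separating `z` does not separate `w`, so the dual
step from `z` to `w` across `x₁x₂` is blocked, i.e. `x₁x₂` is a bond of `P`: the hexagon `x₁` of
`w` lies on `P` and is therefore joined by yellow paths of hexagons (the two parts of `P`) to a
hexagon of `A_{i+1}` and to a hexagon of `A_{i+2}`. Model-free and purely combinatorial; the
blue arm of Claim 10 (the real content of the printed proof) is not treated here.

## References

* B. Bollobás, O. Riordan, *Percolation*, CUP (2006), Ch. 7, Claim 10 p. 177.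
* L. Chayes, H. K. Lei, Rev. Math. Phys. 19 (2007), §2.1–2.3.
-/

noncomputable section

namespace Summit.CriticalPhenomena.CardyFormulaZ2.Theorems

open Literature.Probability.Percolation Literature.Probability.LatticeModels

/-- Along a walk all of whose darts are edges of a second graph `H`, every vertex of the walk is
`H`-reachable from its start. -/
theorem reachable_of_darts_adj {V : Type*} {G H : SimpleGraph V} {u v : V} (P : G.Walk u v)
    (h : ∀ d ∈ P.darts, H.Adj d.fst d.snd) : ∀ x ∈ P.support, H.Reachable u x := by
  induction P with
  | nil =>
    intro x hx
    rw [SimpleGraph.Walk.support_nil, List.mem_singleton] at hx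
    subst hx
    rfl
  | cons hadj P' ih =>
    intro x hx
    rw [SimpleGraph.Walk.support_cons, List.mem_cons] at hx
    have h1 : H.Adj _ _ := h ⟨(_, _), hadj⟩ (by simp)
    rcases hx with rfl | hx
    · rfl
    · exact h1.reachable.trans (ih (fun d hd => h d (by simp [hd])) x hx)

/-- **The two yellow arms of Claim 10 for the Chayes–Lei separating events** (Bollobás–Riordan
2006, Ch. 7, Claim 10 p. 177, first part of the proof, for yellow paths of hexagons with
half-edge connectivity): for a triangle `w` of the 3-marked domain `G` and its dual neighbour
`z = oppFace w j`, on `Eⁱ(z) ∖ Eⁱ(w)` the separating yellow path `P` uses the bond `x₁x₂` dual to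
the edge `wz` (otherwise the dual step `z → w` followed by the dual chain escaping from `w` would
escape from `z`), so its hexagon `x₁` (a vertex of `w`) is yellow-connected, along the two parts
of `P`, to a hexagon of `A_{i+1}` and to a hexagon of `A_{i+2}`. -/
theorem clSepEvent_diff_subset_yellowArms : ∀ (D : Literature.Probability.Percolation.TriMarkedDomain 3) (w : Literature.Probability.LatticeModels.HexVertex) (i j : Fin 3), Literature.Probability.LatticeModels.hexFaceVertices w ⊆ D.verts → D.clSepEvent i (Literature.Probability.Percolation.oppFace w j) \ D.clSepEvent i w ⊆ {σ | ∃ k : Fin 3, (∃ u ∈ D.arc (i + 1), (Literature.Probability.Percolation.clYellowGraph σ).Reachable (Literature.Probability.Percolation.faceVertex w k) u) ∧ (∃ u ∈ D.arc (i + 2), (Literature.Probability.Percolation.clYellowGraph σ).Reachable (Literature.Probability.Percolation.faceVertex w k) u)} := by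
  classical
  intro D w i j hwD σ hσ
  obtain ⟨hz, hw⟩ := hσ
  obtain ⟨du, dv, P, hP, hu, hv, hyu, hyv, hsupp, hdarts, hsep⟩ := hz
  -- `w` is not separated by the bonds of `P`
  have hnsep : ¬ Separates D.verts {e | e ∈ P.edges} w (D.stretch i) := fun h =>
    hw ⟨du, dv, P, hP, hu, hv, hyu, hyv, hsupp, hdarts, h⟩
  simp only [Separates, not_forall, not_not] at hnsep
  obtain ⟨F, hF, hwF⟩ := hnsep
  -- hence the dual step `z → w` is blocked: `x₁x₂` is a bond of `P`
  have hstep : ¬ DualStep D.verts {e | e ∈ P.edges} (oppFace w j) w := fun hs =>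
    hsep F hF (Relation.ReflTransGen.head hs hwF)
  have hadj : hexGraph.Adj (oppFace w j) w := (hexGraph_adj_oppFace w j).symm
  have hsub : faceEdge (oppFace w j) w ⊆ D.verts := Finset.inter_subset_right.trans hwD
  have hC : ¬ ∀ a b : Site 2, faceEdge (oppFace w j) w = {a, b} → s(a, b) ∉ {e | e ∈ P.edges} :=
    fun h => hstep ⟨hadj, hsub, h⟩
  push Not at hC
  obtain ⟨a, b, hab, habP⟩ := hC
  rw [Set.mem_setOf_eq] at habP
  -- `a` is a vertex of `w` on `P`
  have ha : a ∈ hexFaceVertices w := by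
    have : a ∈ faceEdge (oppFace w j) w := by rw [hab]; simp
    exact (Finset.mem_inter.1 this).2
  obtain ⟨k, rfl⟩ := mem_hexFaceVertices_iff_faceVertex.mp ha
  have haP : faceVertex w k ∈ P.support := P.fst_mem_support_of_mem_edges habP
  -- every hexagon of `P` is yellow-reachable from its start
  have hreach := reachable_of_darts_adj P hdarts
  refine ⟨k, ⟨du.1, Finset.mem_image_of_mem Prod.fst hu, (hreach _ haP).symm⟩,
    ⟨dv.1, Finset.mem_image_of_mem Prod.fst hv, ?_⟩⟩
  exact (hreach _ haP).symm.trans (hreach _ P.end_mem_support)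

end Summit.CriticalPhenomena.CardyFormulaZ2.Theorems

end
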